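import Summits.BirchSwinnertonDyer.BirchSwinnertonDyer.Theorems.GenusKolyvaginAtTwoShaConsistencyLawFree
import Summits.BirchSwinnertonDyer.BirchSwinnertonDyer.Theorems.GenusKolyvaginAtTwoGenusDeepSupplyAtTwoNegDiscNarrowKFourCellPrintOnly
import Summits.BirchSwinnertonDyer.BirchSwinnertonDyer.Theorems.GenusKolyvaginAtTwoGenusPrimitiveSupplyAtTwoPosDiscShallowKFourPosCellCapitulation
import Summits.BirchSwinnertonDyer.BirchSwinnertonDyer.Theorems.GenusKolyvaginAtTwoGenusPrimitiveSupplyAtTwoPosDiscShallowKFourPosCellShaTwoRank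
import HarnessLib

/-!
# Route `GenusKolyvaginAtTwo`, cruxes 23491 (K₄ = `K4Neg`, stmt-BirchSwinnertonDyer-31526) / 25504 (K₄⁺ = `K4Pos`, stmt-BirchSwinnertonDyer-31469):
# `#Ш(E_K/K)[2^∞] = #Ш(E/ℚ)[2^∞]` AND `Ш(E_K/K)[2^∞] ≃ Ш(E/ℚ)[2^∞] ≃ ℤ/2^e × ℤ/2^e` ON THE K₄ AND K₄⁺ CELLS — no Cassels–Tate adjointness,
# no Kolyvagin relation Q2, no Gross 3.7 (2); only the cells' binders and the three GZK-level count binders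

Seat `bsd-line-gk2-p4` g29 (cell `bsd-f1-sign2`), WIDTH-5 attach on route `GenusKolyvaginAtTwo` rev 59; sequel of `…ShaConsistencyLawFree`
(the frame-level, `hRC`-free consistency law ★ and the common one-block structure).  THEOREMS ONLY (no definition, no named fact, no `sorry`);
standard axioms.  **BSD is NOT proved by this file; K4Neg / K4Pos are NOT proved; no item is closed.**

WHAT.  The frame hypotheses of ★ are DISCHARGED on the two cells from the cells' own packages:
* the pair-sandwich frame (`E(K)[2] = 0`, `rank E(K) ≤ 1`, the Heegner point `y_K ∈ E(K)` under `P(1)` with `σy_K + y_K` torsion and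
  `2^(M₀+1) ∤ y_K`, `Ш(E^(d_K)/ℚ)[2^∞] = 0`) from gk2-p3's sign-free `PlusDescent.exists_frame_of_cut` (inputs: `ρ̄_{E,2}` onto, `w(E) = +1`
  — here from `r_an(E) = 0` and the newform of `Dt` —, `rank E(ℚ) = 0`, the `2`-Selmer-minimal twin);
* `#Ш(E_K/K)[2] = 4` from the LEAD's `KFourCell.natCard_shaTorsionBy_two_baseChange_eq_four_of_cell'` (K₄, Poitou–Tate / Euler–Poincaré
  discharged, p769164) resp. gk2-p5's `KFourPosCell.natCard_shaTorsionBy_two_baseChange_eq_four_of_kFourPos` (K₄⁺, p765790);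
* the capitulating class: the LEAD's / gk2-p5's `s_y ∈ Sel₂(E/ℚ) ∖ 0` with `res_K s_y = κ₂(y_K/2^{M₀})` (`…of_depth_pos_of_cell'`, p768636/p769164;
  `KFourPosCell.existsUnique_resTorsion_eq_kummer_of_depth_pos`, p767715), pushed to `η = ι(s_y) ∈ Ш(E/ℚ)[2]` — non-zero because `E(ℚ)` is
  `2`-divisible (`rank E(ℚ) = 0`, odd torsion from `ρ̄_{E,2}` onto; `PlusDescent.torsionH1ToH1_injective_of_divisible`) and killed by `res`
  (`torsionH1ToH1_resTorsion` + `torsionH1ToH1_kummerMapTorsion`).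
RESULTS (displayed count binders: `rank E(ℚ) = 0`, `Ш(E/ℚ)[2^∞]` and `Ш(E_K/K)[2^∞]` finite — on the cells these are Gross–Zagier–Kolyvagin for
`E` and `E^(d_K)`, i.e. the route's print item `MultPublishedInputsAtTwo` 19921; `rank E(K) = 1` is DERIVED):
* §1 `natCard_shaPrimary_baseChange_eq_rat_of_kFourNeg_cell` — K₄ cell (Δ < 0, prime frame, `M₀ ≥ 1` implicit in the capitulation datum):
  **`#Ш(E_K/K)[2^∞] = #Ш(E/ℚ)[2^∞]`, `#Ш(E/ℚ)[2] = 4`, and ONE `e ≥ 1` with `Ш(E_K/K)[2^∞] ≃ Ш(E/ℚ)[2^∞] ≃ ℤ/2^e × ℤ/2^e`**;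
* §2 `natCard_shaPrimary_baseChange_eq_rat_of_kFourPos_cell` — the same on the K₄⁺ cell (Δ > 0, real-narrow `#Sel₂(E) = 4` cell, shallow twin).
READING (LEAD-BRIEF-g23-ADDENDUM B.3, now `hRC`-free): on K₄ / K₄⁺, Kolyvagin exactness over `K` (`#Ш(E_K)[2^∞] = 4^(M₀)`: Q3R_T′ / Q4_T″,
proved) IS `#Ш(E/ℚ)[2^∞] = 4^(M₀)` — the 2-part of the BSD cardinality for the rank-0 curve `E/ℚ` given the Gross–Zagier–Kolyvagin index `M₀`;
and U_T (`e ≤ M₀` over `K`) is B₂ (`e ≤ M₀` over `ℚ`).  Nothing here computes `e`; K₄ / K₄⁺ (⟺ `e = M₀`) remain open.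

References: [Kramer1981] Thm. 1, Prop. 7, Thm. 2; [GrossLMS1991] §5 Prop. 5.3; [Cassels1962ArithmeticIV] §1; [SilvermanAEC2009] VIII.§2, X.4.2,
X.4.14; [McCallumLMS1991] §5; [Darmon2004] Prop. 3.11.
-/

set_option autoImplicit false
set_option linter.dupNamespace false -- `Summit.<P>.<Sub>` repeats `BirchSwinnertonDyer` (D-0017)

noncomputable section

open scoped Classical

namespace Summit.BirchSwinnertonDyer.BirchSwinnertonDyer.Theorems.GenusExact.ShaCores

open WeierstrassCurve NumberField IsDedekindDomain Field AddSubgroup Literature.NumberTheory.EllipticCurves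
  Literature.NumberTheory.GaloisRepresentations Literature.NumberTheory.EllipticCurves.ModularForms
  Literature.NumberTheory.EllipticCurves.RingClassField
open Summit.BirchSwinnertonDyer.BirchSwinnertonDyer.Theorems.GenusExact.PlusDescent
open Summit.BirchSwinnertonDyer.BirchSwinnertonDyer.Theorems.GenusSupplyNarrow

variable (W : WeierstrassCurve ℚ) [W.IsElliptic] [W.IsGloballyMinimal] [NeZero (W.conductorNorm ℤ)]
variable (K : Type) [Field K] [NumberField K]

/-! ## §0 The capitulating class as an element of `Ш(E/ℚ)[2^∞]` killed by `res` -/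

omit [W.IsGloballyMinimal] [NeZero (W.conductorNorm ℤ)] in
/-- **From a Selmer class capitulating in `K` to the frame's `hKr`.**  `E = W/ℚ` with `rank E(ℚ) = 0` and `ρ̄_{E,2}` onto (so `E(ℚ)` is finite of
odd order, hence `2^n`-divisible); `s ∈ Sel_{2^n}(E/ℚ)` NON-ZERO whose restriction to `K` is a Kummer class `κ(Q₀)`.  Then `η = ι(s) ∈ H¹(ℚ, E)` lies in
`Ш(E/ℚ)[2^∞]`, is non-zero (`ι` injective on a `2^n`-divisible Mordell–Weil group) and dies in `H¹(K, E_K)` (`res ι s = ι_K res s = ι_K κ(Q₀) = 0`).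
[cite: SilvermanAEC2009, VIII.§2, Thm. X.4.2 (a)] [cite: Kramer1981, Thm. 1, Prop. 7] -/
theorem exists_kramerClass_mem_shaPrimary_of_resTorsion_eq_kummer (hrk0 : W.mordellWeilRank = 0) (hs2 : W.HasSurjectiveModNGaloisRep 2)
    (n : ℕ) (hdivK : ∀ X : geomPoints (W.baseChange K), ∃ Y : geomPoints (W.baseChange K), ((2 ^ n : ℕ) : ℤ) • Y = X)
    {s : galH1Torsion W ((2 ^ n : ℕ) : ℤ)} (hsel : s ∈ W.selmerGroup ((2 ^ n : ℕ) : ℤ)) (hs0 : s ≠ 0)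
    {Q₀ : (W.baseChange K).toAffine.Point}
    (hres : resTorsion W K ((2 ^ n : ℕ) : ℤ) s = kummerMapTorsion (W.baseChange K) ((2 ^ n : ℕ) : ℤ) hdivK Q₀) :
    ∃ η : W.galH1, η ∈ (AddCommGroup.primaryComponent (↥W.sha) 2).map W.sha.subtype ∧ η ≠ 0 ∧ resBaseChange W K η = 0 := by
  haveI : Fact (Nat.Prime 2) := ⟨Nat.prime_two⟩
  have hn0 : ((2 ^ n : ℕ) : ℤ) ≠ 0 := by positivity
  set η : W.galH1 := torsionH1ToH1 W ((2 ^ n : ℕ) : ℤ) s with hη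
  have hηsha : η ∈ W.sha := torsionH1ToH1_mem_sha_of_mem_selmerGroup W hn0 hsel
  have hη2 : 2 ^ n • η = 0 := by
    rw [hη, ← map_nsmul, nsmul_galH1Torsion_natCast_eq_zero W (2 ^ n) s, map_zero]
  refine ⟨η, AddSubgroup.mem_map.mpr ⟨⟨η, hηsha⟩, (AddCommGroup.mem_primaryComponent).mpr ⟨n, Subtype.ext ?_⟩, rfl⟩, ?_, ?_⟩
  · rw [AddSubgroupClass.coe_nsmul, ZeroMemClass.coe_zero]; exact hη2
  · -- `ι` is injective: `E(ℚ)` is `2^n`-divisible (rank `0`, odd torsion)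
    have hdivQ := exists_zsmul_two_pow_eq_of_rank_zero_of_odd_torsionOrder W hrk0
      (PlusDescent.odd_torsionOrder_of_hasSurjectiveModNGaloisRep_two W hs2) n
    -- (`convert`: the two statements carry different `DecidableEq ℚ` instances on `E(ℚ)`)
    have hinj := torsionH1ToH1_injective_of_divisible W hn0 (by convert hdivQ)
    intro h0
    exact hs0 (hinj (by rw [← hη, h0, map_zero]))
  · rw [hη, ← torsionH1ToH1_resTorsion, hres, torsionH1ToH1_kummerMapTorsion]

/-! ## §1 The K₄ cell (Δ < 0, crux 23491 / item 31526) -/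

/-- **`#Ш(E_K/K)[2^∞] = #Ш(E/ℚ)[2^∞]` and the common structure `ℤ/2^e × ℤ/2^e` ON THE K₄ CELL** (crux 23491's `#Sel₂(E) = 4` cell, prime Heegner
frame `K = ℚ(√−ℓ₀)` with `2` split, `2`-Selmer-minimal twin; the capitulation datum `2^(M₀) ∥ P(1)`): binders = the LEAD's K₄-cell package
(`…KFourCellPrintOnly`) + `r_an(E) = 0`, `d_K·Δ ∉ ℚ²`, the datum, and the three COUNT binders `rank E(ℚ) = 0`, `Ш(E/ℚ)[2^∞]` finite,
`Ш(E_K/K)[2^∞]` finite (Gross–Zagier–Kolyvagin for `E` and `E^(d_K)`; `rank E(K) = 1` and `E(K)[2] = 0` are derived).  Conclusion: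
`#Ш(E_K/K)[2^∞] = #Ш(E/ℚ)[2^∞]`, `#Ш(E/ℚ)[2] = 4`, and `∃ e ≥ 1`, `Ш(E_K/K)[2^∞] ≃ ℤ/2^e × ℤ/2^e ≃ Ш(E/ℚ)[2^∞]`, both of order `4^e`.
NO Cassels–Tate adjointness, NO Q2, NO Gross 3.7 (2).  BSD / K4Neg are NOT proved by this (K4Neg ⟺ `e = M₀`, open).
[cite: Kramer1981, Thm. 1, Prop. 7, Thm. 2] [cite: Cassels1962ArithmeticIV, §1] [cite: GrossLMS1991, §5 Prop. 5.3] [cite: SilvermanAEC2009, Thm. X.4.14] -/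
theorem natCard_shaPrimary_baseChange_eq_rat_of_kFourNeg_cell
    (hΔ : W.Δ < 0) (hs2 : W.HasSurjectiveModNGaloisRep 2) (h4 : Nat.card (W.selmerGroup 2) = 4)
    (hK : IsImaginaryQuadratic K) (hodd : Odd (discr K)) (hH : SatisfiesHeegnerHypothesis (W.conductorNorm ℤ) K)
    (h2K : ((Ideal.span {(2 : ℤ)}).primesOver (𝓞 K)).ncard = 2)
    {ℓ₀ : ℕ} [Fact ℓ₀.Prime] (hd : discr K = -(ℓ₀ : ℤ))
    (Wd : WeierstrassCurve ℚ) [Wd.IsElliptic] (hWd : ∃ C : VariableChange ℚ, C • W.quadraticTwist (discr K : ℚ) = Wd)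
    (hSel : Nat.card (Wd.selmerGroup 2) = 2) {σ₀ : K ≃ₐ[ℚ] K} (hσ₀ : σ₀ ≠ 1)
    (hr0 : W.analyticRank = 0) (hsq : ¬ IsSquare ((NumberField.discr K : ℚ) * W.Δ))
    (Dt : ModularParametrizationData W (W.conductorNorm ℤ)) (β : ℤ) (ι : K →+* ℂ) (d₁ : KolyvaginHeegnerData Dt β ι 1)
    (hy : ¬ IsOfFinAddOrder d₁.derivedPoint) {M₀ : ℕ}
    (hdiv : ∃ Q : (W.baseChange (ringClassField K ι 1)).toAffine.Point, ((2 ^ M₀ : ℕ) : ℤ) • Q = d₁.derivedPoint)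
    (hndiv : ¬ ∃ Q : (W.baseChange (ringClassField K ι 1)).toAffine.Point, ((2 ^ (M₀ + 1) : ℕ) : ℤ) • Q = d₁.derivedPoint)
    (hrk0 : W.mordellWeilRank = 0)
    [Finite (AddCommGroup.primaryComponent (↥W.sha) 2)] [Finite (AddCommGroup.primaryComponent (↥(W.baseChange K).sha) 2)] :
    Nat.card (AddCommGroup.primaryComponent (↥(W.baseChange K).sha) 2) = Nat.card (AddCommGroup.primaryComponent (↥W.sha) 2) ∧
      Nat.card (AddSubgroup.torsionBy (↥W.sha) ((2 : ℕ) : ℤ)) = 4 ∧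
      ∃ e : ℕ, 1 ≤ e ∧
        Nonempty (AddCommGroup.primaryComponent (↥(W.baseChange K).sha) 2 ≃+ ZMod (2 ^ e) × ZMod (2 ^ e)) ∧
        Nonempty (AddCommGroup.primaryComponent (↥W.sha) 2 ≃+ ZMod (2 ^ e) × ZMod (2 ^ e)) ∧
        Nat.card (AddCommGroup.primaryComponent (↥(W.baseChange K).sha) 2) = 4 ^ e ∧
        Nat.card (AddCommGroup.primaryComponent (↥W.sha) 2) = 4 ^ e := by
  haveI : Fact (Nat.Prime 2) := ⟨Nat.prime_two⟩
  haveI hell : (W.baseChange K).IsElliptic := inferInstanceAs ((W.map (algebraMap ℚ K)).IsElliptic)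
  have h2 : Module.finrank ℚ K = 2 := hK.1
  -- `w(E) = +1` from `r_an(E) = 0`
  have hw : W.rootNumber = 1 :=
    (Literature.Barriers.BirchSwinnertonDyer.even_analyticRank_iff_of_isNewformOf_conductorLevel Dt.isNewformOf).mp
      (by rw [hr0]; exact Even.zero)
  -- the pair-sandwich frame from the cut data
  obtain ⟨h2tors, hrk1, ⟨y, hndiv', hanti⟩, hT0⟩ :=
    exists_frame_of_cut W K hK hH hs2 hσ₀ Dt β ι d₁ hy M₀ hndiv hw hrk0 Wd hWd hSel
  have hL : ∀ P : (W.baseChange K).toAffine.Point, ((2 : ℕ) : ℤ) • P = 0 → P = 0 := fun P hP ↦ h2tors P (by exact_mod_cast hP)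
  -- `rank E(K) = 1`: the Heegner point under `P(1)` has infinite order
  have hrk : (W.baseChange K).mordellWeilRank = 1 := by
    obtain ⟨Ph, -, hPhmap⟩ := AdditiveKoly.exists_isHeegnerPoint_map_eq_derivedPoint_one (W := W) (K := K) (Dt := Dt) (β := β)
      (ι := ι) hK hH d₁
    have hPhnt : ¬ IsOfFinAddOrder Ph := fun h ↦ hy (by rw [← hPhmap]; exact AddMonoidHom.isOfFinAddOrder _ h)
    haveI : Module.Finite ℤ (W.baseChange K).toAffine.Point := (W.baseChange K).module_finite_point_holds
    have h1 : 1 ≤ (W.baseChange K).mordellWeilRank :=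
      Literature.NumberTheory.EllipticCurves.one_le_mordellWeilRank_of_not_isOfFinAddOrder (W.baseChange K) inferInstance hPhnt
    omega
  -- `#Ш(E_K/K)[2] = 4` (LEAD, unconditional)
  have hX4 := (KFourCell.natCard_shaTorsionBy_two_baseChange_eq_four_of_cell' W K hΔ h4 hK hodd hH h2K hd Wd hWd hSel hL hrk).1
  -- the capitulating class
  have hdiv₂ : ∀ X : geomPoints (W.baseChange K), ∃ Y : geomPoints (W.baseChange K), ((2 ^ 1 : ℕ) : ℤ) • Y = X :=
    (W.baseChange K).zsmul_geomPoints_surjective_of_charZero (by norm_num)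
  obtain ⟨P₀, Q₀, -, -, -, -, ⟨s, ⟨hsres, hssel⟩, -⟩, hsne⟩ :=
    KFourCell.existsUnique_resTorsion_eq_kummer_of_depth_pos_of_cell' W K hΔ hs2 h4 hK hodd hH h2K hd Wd hWd hSel hσ₀ hr0 hsq Dt β ι d₁
      hdiv hndiv hdiv₂
  have hKr := exists_kramerClass_mem_shaPrimary_of_resTorsion_eq_kummer W K hrk0 hs2 1 hdiv₂ hssel (hsne s hsres) hsres
  -- ★ and the common structure
  refine ⟨natCard_shaPrimary_eq_natCard_shaPrimary_rat_of_kramerClass_mem_of_frame W K hK hσ₀ h2tors hrk1 y M₀ hndiv' hanti hT0 hKr hX4,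
    natCard_shaTorsionBy_two_rat_eq_four_of_kramerClass_mem_of_frame W K h2 hσ₀ h2tors hrk1 y M₀ hndiv' hanti hKr hX4,
    exists_addEquiv_shaPrimary_prod_of_kramerClass_mem_of_frame W K hK hσ₀ h2tors hrk1 y M₀ hndiv' hanti hT0 hKr hX4⟩

/-! ## §2 The K₄⁺ cell (Δ > 0, crux 25504 / item 31469) -/

/-- **`#Ш(E_K/K)[2^∞] = #Ш(E/ℚ)[2^∞]` and the common structure `ℤ/2^e × ℤ/2^e` ON THE K₄⁺ CELL** (crux 25504's real-narrow `#Sel₂(E) = 4` cell,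
odd Tamagawa product, prime Heegner frame with `2` split, shallow `2`-Selmer-minimal twin `ord₂ C(Wd) = 0`; the datum `2^(M₀) ∥ P(1)`): binders =
gk2-p5's K₄⁺-cell package (`…KFourPosCellShaTwoRank`, `…KFourPosCellCapitulation`) + the three COUNT binders `rank E(ℚ) = 0`, `Ш(E/ℚ)[2^∞]` finite,
`Ш(E_K/K)[2^∞]` finite.  Conclusion as in §1.  NO Cassels–Tate adjointness, NO Q2.  BSD / K4Pos are NOT proved by this (K4Pos ⟺ `e = M₀`, open).
[cite: Kramer1981, Thm. 1, Prop. 7, Thm. 2] [cite: Cassels1962ArithmeticIV, §1] [cite: GrossLMS1991, §5 Prop. 5.3] [cite: SilvermanAEC2009, Thm. X.4.14] -/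
theorem natCard_shaPrimary_baseChange_eq_rat_of_kFourPos_cell
    (hpos : 0 < W.Δ) (hs2 : W.HasSurjectiveModNGaloisRep 2) (hTam : Odd W.tamagawaProduct)
    (h4 : Nat.card (W.selmerGroup 2) = 4 ∧ ∃ c ∈ (W.kummerSelmerStructure ((2 : ℕ) : ℤ)).selmerGroup,
      galoisCohomology.localization (W.torsionGaloisModule ((2 : ℕ) : ℤ)) (Sum.inl Rat.infinitePlace) 1 c ≠ 0)
    (hK : IsImaginaryQuadratic K) (hodd : Odd (discr K)) (hH : SatisfiesHeegnerHypothesis (W.conductorNorm ℤ) K)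
    (h2K : ((Ideal.span {(2 : ℤ)}).primesOver (𝓞 K)).ncard = 2) {σ₀ : K ≃ₐ[ℚ] K} (hσ₀ : σ₀ ≠ 1)
    {Wd : WeierstrassCurve ℚ} [Wd.IsElliptic] (Cd : VariableChange ℚ) (hCd : Cd • W.quadraticTwist (discr K : ℚ) = Wd)
    (hDEF : padicValNat 2 Wd.tamagawaProduct = 0) (hSel : Nat.card (Wd.selmerGroup 2) = 2)
    (hr0 : W.analyticRank = 0) (hsq : ¬ IsSquare ((NumberField.discr K : ℚ) * W.Δ))
    (Dt : ModularParametrizationData W (W.conductorNorm ℤ)) (β : ℤ) (ι : K →+* ℂ) (d₁ : KolyvaginHeegnerData Dt β ι 1)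
    (hy : ¬ IsOfFinAddOrder d₁.derivedPoint) {M₀ : ℕ}
    (hdiv : ∃ Q : (W.baseChange (ringClassField K ι 1)).toAffine.Point, ((2 ^ M₀ : ℕ) : ℤ) • Q = d₁.derivedPoint)
    (hndiv : ¬ ∃ Q : (W.baseChange (ringClassField K ι 1)).toAffine.Point, ((2 ^ (M₀ + 1) : ℕ) : ℤ) • Q = d₁.derivedPoint)
    (hrk0 : W.mordellWeilRank = 0)
    [Finite (AddCommGroup.primaryComponent (↥W.sha) 2)] [Finite (AddCommGroup.primaryComponent (↥(W.baseChange K).sha) 2)] :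
    Nat.card (AddCommGroup.primaryComponent (↥(W.baseChange K).sha) 2) = Nat.card (AddCommGroup.primaryComponent (↥W.sha) 2) ∧
      Nat.card (AddSubgroup.torsionBy (↥W.sha) ((2 : ℕ) : ℤ)) = 4 ∧
      ∃ e : ℕ, 1 ≤ e ∧
        Nonempty (AddCommGroup.primaryComponent (↥(W.baseChange K).sha) 2 ≃+ ZMod (2 ^ e) × ZMod (2 ^ e)) ∧
        Nonempty (AddCommGroup.primaryComponent (↥W.sha) 2 ≃+ ZMod (2 ^ e) × ZMod (2 ^ e)) ∧
        Nat.card (AddCommGroup.primaryComponent (↥(W.baseChange K).sha) 2) = 4 ^ e ∧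
        Nat.card (AddCommGroup.primaryComponent (↥W.sha) 2) = 4 ^ e := by
  haveI : Fact (Nat.Prime 2) := ⟨Nat.prime_two⟩
  haveI hell : (W.baseChange K).IsElliptic := inferInstanceAs ((W.map (algebraMap ℚ K)).IsElliptic)
  have h2 : Module.finrank ℚ K = 2 := hK.1
  have hWd : ∃ C : VariableChange ℚ, C • W.quadraticTwist (discr K : ℚ) = Wd := ⟨Cd, hCd⟩
  -- `w(E) = +1` from `r_an(E) = 0`
  have hw : W.rootNumber = 1 :=
    (Literature.Barriers.BirchSwinnertonDyer.even_analyticRank_iff_of_isNewformOf_conductorLevel Dt.isNewformOf).mp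
      (by rw [hr0]; exact Even.zero)
  -- the pair-sandwich frame from the cut data
  obtain ⟨h2tors, hrk1, ⟨y, hndiv', hanti⟩, hT0⟩ :=
    exists_frame_of_cut W K hK hH hs2 hσ₀ Dt β ι d₁ hy M₀ hndiv hw hrk0 Wd hWd hSel
  -- `rank E(K) = 1`
  have hrk : (W.baseChange K).mordellWeilRank = 1 := by
    obtain ⟨Ph, -, hPhmap⟩ := AdditiveKoly.exists_isHeegnerPoint_map_eq_derivedPoint_one (W := W) (K := K) (Dt := Dt) (β := β)
      (ι := ι) hK hH d₁
    have hPhnt : ¬ IsOfFinAddOrder Ph := fun h ↦ hy (by rw [← hPhmap]; exact AddMonoidHom.isOfFinAddOrder _ h)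
    haveI : Module.Finite ℤ (W.baseChange K).toAffine.Point := (W.baseChange K).module_finite_point_holds
    have h1 : 1 ≤ (W.baseChange K).mordellWeilRank :=
      Literature.NumberTheory.EllipticCurves.one_le_mordellWeilRank_of_not_isOfFinAddOrder (W.baseChange K) inferInstance hPhnt
    omega
  -- `#Ш(E_K/K)[2] = 4` (gk2-p5, unconditional)
  have hX4 := (KFourPosCell.natCard_shaTorsionBy_two_baseChange_eq_four_of_kFourPos W K hpos hs2 hTam h4 hK hodd hH h2K hσ₀ Cd hCd hDEF
    hrk).1
  -- the capitulating class
  obtain ⟨P₀, Q₀, -, -, -, -, ⟨s, ⟨hsres, hssel⟩, -⟩, hsne⟩ :=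
    KFourPosCell.existsUnique_resTorsion_eq_kummer_of_depth_pos W K hpos hs2 hTam h4 hK hodd hH h2K Cd hCd hDEF hσ₀ hr0 hsq Dt β ι d₁
      hdiv hndiv
  have hKr := exists_kramerClass_mem_shaPrimary_of_resTorsion_eq_kummer W K hrk0 hs2 1
    (by simpa using GenusKolyArch.hdiv_two_baseChange W K) (by simpa using hssel) (hsne s hsres) (by simpa using hsres)
  -- ★ and the common structure
  refine ⟨natCard_shaPrimary_eq_natCard_shaPrimary_rat_of_kramerClass_mem_of_frame W K hK hσ₀ h2tors hrk1 y M₀ hndiv' hanti hT0 hKr hX4,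
    natCard_shaTorsionBy_two_rat_eq_four_of_kramerClass_mem_of_frame W K h2 hσ₀ h2tors hrk1 y M₀ hndiv' hanti hKr hX4,
    exists_addEquiv_shaPrimary_prod_of_kramerClass_mem_of_frame W K hK hσ₀ h2tors hrk1 y M₀ hndiv' hanti hT0 hKr hX4⟩

end Summit.BirchSwinnertonDyer.BirchSwinnertonDyer.Theorems.GenusExact.ShaCores

end
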